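import Mathlib
import Summits.QuantumFields.QCD.Theses.PauliWegnerSea
import Literature.MathematicalPhysics.QuantumFieldTheory.QCDHeavyQuarkPropagator
import Literature.MathematicalPhysics.QuantumFieldTheory.QCDWickMinorMeasurability
import Literature.MathematicalPhysics.QuantumFieldTheory.QCDPhaseQuenchedPositivity

/-!
# The minor-moments core forces its reg-free UNIFORM pencil form
(crux `Summit.QuantumFields.QCD.Theses.PauliWegnerSea.PhaseQuenchedFlavourDecay`, item stmt-QuantumFields-9151,
line `crossing-split-integrability`, registered additive stub `stub_uniformPencil_of_minorMomentsCore`)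

`QCDRegularisation Nf` pins only `a_k > 0`, `a_k → 0`, `a_k L_k → ∞`, `Z_m(k) > 0`; the couplings `β_k`,
the critical masses `m_crit(k)` and the ratios `λ_k = a_k / Z_m(k) > 0` are free, so a regularisation can
VISIT any sequence of lattice parameter points `(β, c, λ)` with bare masses on the pencil `c + λ m`.
Hence the registered core `stub_minorMomentsCore` (Fredenhagen–Marcu decay `Upper` along a
regularisation ⟹ eventually uniform `(1+ε)`-moments of all `r × r` Wick minors) forces constants that are
UNIFORM over all parameter points sharing the Fredenhagen–Marcu data `(s, C)`:

* `uniformPencil_diagonal` — the diagonal argument with the Fredenhagen–Marcu functional `FM` and the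
  moment predicate `Good` kept OPAQUE.  If the uniform form fails, then for every `ε > 0` there is a rank
  `r(ε)` such that for all blocks `(Cr, μ₀, Λ₀) = (b, 1/(b+1), b)` there is a bad point; enumerate the bad
  points `P(j, b)` (`ε_j = 1/(j+1)`) along `k ↦ ((unpair k).1, k)` and assemble them into ONE
  regularisation (`a_k := μ ≤ 1/(k+1) → 0`, `a_k L_k ≥ k → ∞`, `Z_m := a_k/λ`).  The core gives `ε⋆` and,
  for `r⋆ = r(ε_{j⋆})` with `ε_{j⋆} ≤ ε⋆`, a constant `C⋆` valid for all late `k`; at a late `k` on the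
  fibre `(unpair k).1 = j⋆` with `k > C⋆ + 1` the bad point contradicts the monotone transfer
  `Good ε⋆ C⋆ → Good ε_{j⋆} (C⋆ + 1)`.
* `uniformPencil_rpow_moment_transfer` — the one place the minors are opened, and only as a
  non-negative measurable `X` on a probability space: `X^{1+ε'} ≤ 1 + X^{1+ε}` for `0 ≤ 1+ε' ≤ 1+ε`, so
  `∫ X^{1+ε'} ≤ 1 + ∫ X^{1+ε}`.
* `stub_uniformPencil_of_minorMomentsCore` — the REGISTERED signature, by instantiating the two.

Pure logic / filters over the tree's objects; no localisation or decay is claimed.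
-/

noncomputable section

namespace Summit.QuantumFields.QCD.Cruxes.PhaseQuenchedFlavourDecay.CrossingSplitIntegrability

open scoped BigOperators
open MeasureTheory Filter
open Literature.MathematicalPhysics.QuantumFieldTheory Literature.MathematicalPhysics.QuantumLattice
  Literature.Probability.LatticeModels

/-! ### Monotone transfer of `(1+ε)`-moment bounds in the exponent -/

/-- On a probability space, for a non-negative measurable `f` and exponents `0 ≤ q ≤ p`:
if `f ^ p` is integrable then so is `f ^ q`, with `∫ f ^ q ≤ 1 + ∫ f ^ p`
(pointwise `f ^ q ≤ 1 + f ^ p`, by cases `f ≤ 1` / `1 ≤ f`). -/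
theorem uniformPencil_rpow_moment_transfer {Ω : Type*} [MeasurableSpace Ω] (P : Measure Ω)
    [IsProbabilityMeasure P] {f : Ω → ℝ} (hf0 : ∀ ω, 0 ≤ f ω) (hfm : Measurable f) {p q : ℝ}
    (hq : 0 ≤ q) (hpq : q ≤ p) (hfi : Integrable (fun ω => f ω ^ p) P) :
    Integrable (fun ω => f ω ^ q) P ∧ ∫ ω, f ω ^ q ∂P ≤ 1 + ∫ ω, f ω ^ p ∂P := by
  have hle : ∀ ω, f ω ^ q ≤ 1 + f ω ^ p := fun ω => by
    rcases le_or_gt (f ω) 1 with h | h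
    · linarith [Real.rpow_nonneg (hf0 ω) p, Real.rpow_le_one (hf0 ω) h hq]
    · linarith [Real.rpow_le_rpow_of_exponent_le h.le hpq]
  have hint : Integrable (fun ω => 1 + f ω ^ p) P := (integrable_const 1).add hfi
  have hfi' : Integrable (fun ω => f ω ^ q) P := hint.mono' (hfm.pow_const q).aestronglyMeasurable
    (Eventually.of_forall fun ω => by
      rw [Real.norm_eq_abs, abs_of_nonneg (Real.rpow_nonneg (hf0 ω) q)]; exact hle ω)
  refine ⟨hfi', ?_⟩
  calc ∫ ω, f ω ^ q ∂P ≤ ∫ ω, (1 + f ω ^ p) ∂P := integral_mono hfi' hint hle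
    _ = 1 + ∫ ω, f ω ^ p ∂P := by
        rw [integral_add (integrable_const 1) hfi, integral_const, smul_eq_mul, mul_one, probReal_univ]

/-! ### The diagonal argument (opaque Fredenhagen–Marcu functional `FM` and moment predicate `Good`) -/

/-- **Diagonal argument.** `FM β mq S f v` (the Fredenhagen–Marcu quotient at exponent `s`, kept opaque)
and `Good β mq S r I J ε C` ("the `r × r` minor `(I, J)` has phase-quenched `(1+ε)`-moment `≤ C` on the
torus of side `2S+1`", kept opaque up to the monotone transfer `hmono`) are arbitrary.  If the core holds
along EVERY `QCDRegularisation` with `Upper`-data `(s, δ = 1, C)`, then the constants are uniform over the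
pencil `c + λ m` of bare masses, the couplings `β`, and all rates `μ ≤ μ₀`, volumes `μ L ≥ Λ₀`.  Proof by
contradiction: the bad points `P(j, b)` (`ε_j = 1/(j+1)`, block `(Cr, μ₀, Λ₀) = (b, 1/(b+1), b)`) visited along
`k ↦ ((unpair k).1, k)` form an admissible regularisation (`a_k = μ ≤ 1/(k+1)`, `a_k L_k ≥ k`, `Z_m = a_k/λ`,
bare masses `c + a_k m / (a_k/λ) = c + λ m`); the core's `ε⋆`, `C⋆` at rank `r(ε_{j⋆})`, `ε_{j⋆} ≤ ε⋆`, and a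
late `k = pair j⋆ t` with `k > C⋆ + 1` contradict badness via `hmono`. -/
theorem uniformPencil_diagonal {Nf : ℕ} (m : Fin Nf → ℝ)
    (FM : ℝ → (Fin Nf → ℝ) → ℕ → Fin Nf → Literature.Probability.LatticeModels.Site 4 → ℝ)
    (Good : ∀ (β : ℝ) (mq : Fin Nf → ℝ) (S r : ℕ), (Fin r → QuarkVar Nf (2 * S + 1)) →
      (Fin r → QuarkVar Nf (2 * S + 1)) → ℝ → ℝ → Prop) (C : ℝ)
    (hmono : ∀ β mq S r I J (ε ε' C₁ C₂ : ℝ), 0 < ε' → ε' ≤ ε → C₁ + 1 ≤ C₂ →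
      Good β mq S r I J ε C₁ → Good β mq S r I J ε' C₂)
    (hcore : ∀ reg : QCDRegularisation Nf,
      (∀ᶠ k in atTop, ∀ S : ℕ, reg.L k ≤ S →
        ∀ (f : Fin Nf) (v : Literature.Probability.LatticeModels.Site 4), v ∈ box 4 S →
        FM (reg.β k) (fun fl => reg.mcrit k + reg.a k * m fl / reg.Zm k) S f v ≤
          C * Real.exp (-(1 * (reg.a k * ‖v‖)))) →
      ∃ ε : ℝ, 0 < ε ∧ ∀ r : ℕ, ∃ C : ℝ, ∀ᶠ k in atTop, ∀ S : ℕ, reg.L k ≤ S →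
        ∀ I J : Fin r → QuarkVar Nf (2 * S + 1),
          Good (reg.β k) (fun fl => reg.mcrit k + reg.a k * m fl / reg.Zm k) S r I J ε C) :
    ∃ ε : ℝ, 0 < ε ∧ ∀ r : ℕ, ∃ Cr μ₀ Λ₀ : ℝ, 0 < μ₀ ∧ ∀ (β c lam μ : ℝ) (L : ℕ),
      0 < lam → 0 < μ → μ ≤ μ₀ → Λ₀ ≤ μ * L →
      (∀ S : ℕ, L ≤ S → ∀ (f : Fin Nf) (v : Literature.Probability.LatticeModels.Site 4), v ∈ box 4 S →
        FM β (fun fl => c + lam * m fl) S f v ≤ C * Real.exp (-(μ * ‖v‖))) →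
      ∀ S : ℕ, L ≤ S → ∀ I J : Fin r → QuarkVar Nf (2 * S + 1),
        Good β (fun fl => c + lam * m fl) S r I J ε Cr := by
  by_contra H
  push Not at H
  choose r hr using H
  -- the bad points `P(j, b)`: exponent `ε_j = 1/(j+1)`, block `(Cr, μ₀, Λ₀) = (b, 1/(b+1), b)`
  have hjb : ∀ j b : ℕ, ∃ (β c lam μ : ℝ) (L : ℕ), 0 < lam ∧ 0 < μ ∧ μ ≤ 1 / ((b : ℝ) + 1) ∧
      (b : ℝ) ≤ μ * L ∧
      (∀ S : ℕ, L ≤ S → ∀ (f : Fin Nf) (v : Literature.Probability.LatticeModels.Site 4),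
        v ∈ box 4 S → FM β (fun fl => c + lam * m fl) S f v ≤ C * Real.exp (-(μ * ‖v‖))) ∧
      ∃ S : ℕ, L ≤ S ∧ ∃ I J : Fin (r (1 / ((j : ℝ) + 1)) Nat.one_div_pos_of_nat) →
          QuarkVar Nf (2 * S + 1),
        ¬ Good β (fun fl => c + lam * m fl) S _ I J (1 / ((j : ℝ) + 1)) b :=
    fun j b => hr _ _ (b : ℝ) _ (b : ℝ) Nat.one_div_pos_of_nat
  choose β c lam μ L hlam hμ hμle hbL hFM S hLS I J hbad using hjb
  -- ONE regularisation visiting the bad point `((unpair k).1, k)` at step `k`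
  obtain ⟨reg, hrega, hregβ, hregL, hregm⟩ : ∃ reg : QCDRegularisation Nf,
      (∀ k, reg.a k = μ (Nat.unpair k).1 k) ∧ (∀ k, reg.β k = β (Nat.unpair k).1 k) ∧
      (∀ k, reg.L k = L (Nat.unpair k).1 k) ∧
      ∀ k, (fun fl => reg.mcrit k + reg.a k * m fl / reg.Zm k) =
        fun fl => c (Nat.unpair k).1 k + lam (Nat.unpair k).1 k * m fl := by
    refine ⟨⟨fun k => μ (Nat.unpair k).1 k, fun k => hμ _ _, ?_, fun k => β (Nat.unpair k).1 k,
      fun k => L (Nat.unpair k).1 k, ?_, fun k => c (Nat.unpair k).1 k,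
      fun k => μ (Nat.unpair k).1 k / lam (Nat.unpair k).1 k, fun k => div_pos (hμ _ _) (hlam _ _)⟩,
      fun _ => rfl, fun _ => rfl, fun _ => rfl, fun k => funext fun fl => ?_⟩
    · -- `0 < a_k ≤ 1/(k+1) → 0`
      exact squeeze_zero (fun k => (hμ _ _).le) (fun k => hμle _ _)
        tendsto_one_div_add_atTop_nhds_zero_nat
    · -- `a_k L_k ≥ k → ∞`
      exact tendsto_atTop_mono (fun k => hbL _ _) tendsto_natCast_atTop_atTop
    · -- bare masses `c + a_k m / (a_k / λ) = c + λ m`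
      show c _ k + μ _ k * m fl / (μ _ k / lam _ k) = _
      rw [div_div_eq_mul_div, mul_assoc, mul_comm (μ _ k), mul_div_assoc, div_self (hμ _ _).ne',
        mul_one, mul_comm]
  -- the core along `reg`: `Upper` holds with `(s, δ, C) = (s, 1, C)` at EVERY step
  obtain ⟨ε₀, hε₀, hcore₀⟩ := hcore reg (Eventually.of_forall fun k S hS f v hv => by
    rw [hregm k, hregβ k, hrega k, one_mul]
    exact hFM _ k S (hregL k ▸ hS) f v hv)
  -- `ε_{j₀} = 1/(j₀+1) < ε₀`, the core's constant `C₀` at rank `r(ε_{j₀})`, valid from step `k₀` on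
  obtain ⟨j₀, hj₀⟩ := exists_nat_one_div_lt hε₀
  obtain ⟨C₀, hC₀⟩ := hcore₀ (r (1 / ((j₀ : ℝ) + 1)) Nat.one_div_pos_of_nat)
  obtain ⟨k₀, hk₀⟩ := eventually_atTop.1 hC₀
  obtain ⟨N, hN⟩ := exists_nat_gt (C₀ + 1)
  -- a late step on the fibre `(unpair k).1 = j₀` with block parameter `k > C₀ + 1`
  obtain ⟨k, hk₁, hk₂, hjk⟩ : ∃ k : ℕ, k₀ ≤ k ∧ N ≤ k ∧ (Nat.unpair k).1 = j₀ :=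
    ⟨Nat.pair j₀ (max k₀ N), (le_max_left _ _).trans (Nat.right_le_pair _ _),
      (le_max_right _ _).trans (Nat.right_le_pair _ _), by rw [Nat.unpair_pair]⟩
  subst hjk
  have hgood := hk₀ k hk₁ (S _ k) ((hregL k).symm ▸ hLS _ k) (I _ k) (J _ k)
  rw [hregβ k, hregm k] at hgood
  refine hbad _ k (hmono _ _ _ _ _ _ _ _ _ _ Nat.one_div_pos_of_nat hj₀.le ?_ hgood)
  have hNk : (N : ℝ) ≤ k := by exact_mod_cast hk₂
  linarith

/-! ### The registered stub -/

/-- **W4 (registered stub `stub_uniformPencil_of_minorMomentsCore`).** The registered core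
`stub_minorMomentsCore` (hypothesis) implies its reg-free UNIFORM pencil form: for renormalised masses
`m > 0` and Fredenhagen–Marcu data `(s, C)` there are `ε(s, C, m) > 0` and, for every rank `r`, constants
`Cr, μ₀ > 0, Λ₀` such that at EVERY lattice parameter point `(β, c, λ > 0)` with bare masses `c + λ m`,
every rate `0 < μ ≤ μ₀` and every `L` with `Λ₀ ≤ μ L`, Fredenhagen–Marcu decay `FM ≤ C e^{-μ |v|}` on the
volumes `S ≥ L` gives phase-quenched `(1+ε)`-moments `≤ Cr` of all `r × r` Wick minors on those volumes.
`uniformPencil_diagonal` with the concrete `FM`, `Good`, the transfer `uniformPencil_rpow_moment_transfer`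
(`qcdLatticeMeasure` is a probability measure, `isProbabilityMeasure_qcdLatticeMeasure_all`;
`⟨·⟩₊ = ∫ · d(qcdLatticeMeasure)`, `qcdPhaseQuenchedExpect_eq_integral_qcdLatticeMeasure`; minors are
measurable, `measurable_det_inv_diracMatrix`), and the core at `Upper`-data `(s, 1, C)`. -/
theorem stub_uniformPencil_of_minorMomentsCore :
    (∀ (Nf : ℕ) (reg : QCDRegularisation Nf) (m : Fin Nf → ℝ), (∀ f, 0 < m f) → (∃ s δ C : ℝ, 0 < s ∧ s < 1 ∧ 0 < δ ∧ ∀ᶠ k in atTop, ∀ S : ℕ, reg.L k ≤ S → ∀ (f : Fin Nf) (v : Literature.Probability.LatticeModels.Site 4), v ∈ box 4 S → (∫ U : GaugeConfig 4 (2 * S + 1) (Matrix.specialUnitaryGroup (Fin 3) ℂ), ‖(diracMatrix U fun fl => reg.mcrit k + reg.a k * m fl / reg.Zm k).det‖ * (∑ a : Fin 3, ∑ i : Fin 4, ∑ b : Fin 3, ∑ j : Fin 4, ‖(diracMatrix U fun fl => reg.mcrit k + reg.a k * m fl / reg.Zm k)⁻¹ (quarkEquiv (f, (Torus.proj (2 *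 S + 1) 0, a, i))) (quarkEquiv (f, (Torus.proj (2 * S + 1) (v), b, j)))‖) ^ s ∂(wilsonMeasure (fundamentalRep (Fin 3)) (reg.β k))) / (∫ U : GaugeConfig 4 (2 * S + 1) (Matrix.specialUnitaryGroup (Fin 3) ℂ), ‖(diracMatrix U fun fl => reg.mcrit k + reg.a k * m fl / reg.Zm k).det‖ ∂(wilsonMeasure (fundamentalRep (Fin 3)) (reg.β k))) ≤ C * Real.exp (-(δ * (reg.a k * ‖v‖)))) → ∃ ε : ℝ, 0 < ε ∧ ∀ r : ℕ, ∃ C : ℝ, ∀ᶠ k in atTop, ∀ S : ℕ, reg.L k ≤ S → ∀ I J : Fin r → QuarkVar Nf (2 * S + 1), Integrable (fun U : GaugeConfig 4 (2 * S + 1) SU3 => ‖(Matrix.of fun a b : Fin r => (diracMatrix U fun fl => reg.mcrit k + reg.a k * m fl / reg.Zm k)⁻¹ (quarkEquiv (I a)) (quarkEquiv (J b))).det‖ ^ (1 + ε)) (qcdLatticeMeasure (2 * S + 1) (reg.β k) fun fl => reg.mcrit k + reg.a k * m fl / reg.Zm k) ∧ qcdPhaseQuenchedExpect (reg.β k) (2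 * S + 1) (fun fl => reg.mcrit k + reg.a k * m fl / reg.Zm k) (fun U : GaugeConfig 4 (2 * S + 1) SU3 => ‖(Matrix.of fun a b : Fin r => (diracMatrix U fun fl => reg.mcrit k + reg.a k * m fl / reg.Zm k)⁻¹ (quarkEquiv (I a)) (quarkEquiv (J b))).det‖ ^ (1 + ε)) ≤ C) → ∀ (Nf : ℕ) (m : Fin Nf → ℝ), (∀ f, 0 < m f) → ∀ (s C : ℝ), 0 < s → s < 1 → ∃ ε : ℝ, 0 < ε ∧ ∀ r : ℕ, ∃ Cr μ₀ Λ₀ : ℝ, 0 < μ₀ ∧ ∀ (β c lam μ : ℝ) (L : ℕ), 0 < lam → 0 < μ → μ ≤ μ₀ → Λ₀ ≤ μ * L → (∀ S : ℕ, L ≤ S → ∀ (f : Fin Nf) (v : Literature.Probability.LatticeModels.Site 4), v ∈ box 4 S → (∫ U : GaugeConfig 4 (2 * S + 1) (Matrix.specialUnitaryGroup (Fin 3) ℂ), ‖(diracMatrix U fun fl => c + lam * m fl).det‖ * (∑ a : Fin 3, ∑ i : Fin 4, ∑ b : Fin 3, ∑ j : Fin 4, ‖(diracMatrix U fun fl =>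 c + lam * m fl)⁻¹ (quarkEquiv (f, (Torus.proj (2 * S + 1) 0, a, i))) (quarkEquiv (f, (Torus.proj (2 * S + 1) (v), b, j)))‖) ^ s ∂(wilsonMeasure (fundamentalRep (Fin 3)) β)) / (∫ U : GaugeConfig 4 (2 * S + 1) (Matrix.specialUnitaryGroup (Fin 3) ℂ), ‖(diracMatrix U fun fl => c + lam * m fl).det‖ ∂(wilsonMeasure (fundamentalRep (Fin 3)) β)) ≤ C * Real.exp (-(μ * ‖v‖))) → ∀ S : ℕ, L ≤ S → ∀ I J : Fin r → QuarkVar Nf (2 * S + 1), Integrable (fun U : GaugeConfig 4 (2 * S + 1) SU3 => ‖(Matrix.of fun a b : Fin r => (diracMatrix U fun fl => c + lam * m fl)⁻¹ (quarkEquiv (I a)) (quarkEquiv (J b))).det‖ ^ (1 + ε)) (qcdLatticeMeasure (2 * S + 1) β fun fl => c + lam * m fl) ∧ qcdPhaseQuenchedExpect β (2 * S + 1) (fun fl => c + lam * m fl) (fun U : GaugeConfig 4 (2 * S + 1) SU3 => ‖(Matrix.of fun a b : Fin r => (diracMatrix U fun fl => c + lam * m fl)⁻¹ (quarkEquiv (I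 a)) (quarkEquiv (J b))).det‖ ^ (1 + ε)) ≤ Cr := by
  intro hcore Nf m hm s C hs hs1
  exact uniformPencil_diagonal m
    (fun β mq S f v => (∫ U : GaugeConfig 4 (2 * S + 1) (Matrix.specialUnitaryGroup (Fin 3) ℂ),
        ‖(diracMatrix U mq).det‖ * (∑ a : Fin 3, ∑ i : Fin 4, ∑ b : Fin 3, ∑ j : Fin 4,
          ‖(diracMatrix U mq)⁻¹ (quarkEquiv (f, (Torus.proj (2 * S + 1) 0, a, i)))
            (quarkEquiv (f, (Torus.proj (2 * S + 1) (v), b, j)))‖) ^ s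
              ∂(wilsonMeasure (fundamentalRep (Fin 3)) β)) /
      (∫ U : GaugeConfig 4 (2 * S + 1) (Matrix.specialUnitaryGroup (Fin 3) ℂ),
        ‖(diracMatrix U mq).det‖ ∂(wilsonMeasure (fundamentalRep (Fin 3)) β)))
    (fun β mq S r I J ε C' =>
      Integrable (fun U : GaugeConfig 4 (2 * S + 1) SU3 => ‖(Matrix.of fun a b : Fin r =>
          (diracMatrix U mq)⁻¹ (quarkEquiv (I a)) (quarkEquiv (J b))).det‖ ^ (1 + ε))
        (qcdLatticeMeasure (2 * S + 1) β mq) ∧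
      qcdPhaseQuenchedExpect β (2 * S + 1) mq (fun U : GaugeConfig 4 (2 * S + 1) SU3 =>
        ‖(Matrix.of fun a b : Fin r =>
          (diracMatrix U mq)⁻¹ (quarkEquiv (I a)) (quarkEquiv (J b))).det‖ ^ (1 + ε)) ≤ C')
    C
    (fun β mq S r I J ε ε' C₁ C₂ hε' hle hC h => by
      haveI := isProbabilityMeasure_qcdLatticeMeasure_all (S := 2 * S + 1) β mq
      rw [qcdPhaseQuenchedExpect_eq_integral_qcdLatticeMeasure] at h ⊢
      obtain ⟨h1, h2⟩ := uniformPencil_rpow_moment_transfer (qcdLatticeMeasure (2 * S + 1) β mq)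
        (fun U => norm_nonneg _)
        (measurable_det_inv_diracMatrix mq (fun a => quarkEquiv (I a)) (fun b => quarkEquiv (J b))).norm
        (p := 1 + ε) (q := 1 + ε') (by linarith) (by linarith) h.1
      exact ⟨h1, by linarith [h.2]⟩)
    (fun reg hup => hcore Nf reg m hm ⟨s, 1, C, hs, hs1, one_pos, hup⟩)


end Summit.QuantumFields.QCD.Cruxes.PhaseQuenchedFlavourDecay.CrossingSplitIntegrability
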